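import Literature.Topology.FourManifolds.LatticeFormsIndefiniteProofs
import Literature.Topology.FourManifolds.LatticeFormsDiagonal
import Literature.Topology.FourManifolds.LatticeFormsParity
import Literature.Topology.FourManifolds.LatticeFormsProofs
import Literature.LinearAlgebra.QuadraticForm.WittExtension

/-!
# Route NikulinTwinTransport · `RealMultiplicationSqrtTwoAlgebraic` (stmt-HodgeConjecture-13679) —
# every unimodular lattice of EVEN rank has a rational `2`-self-similitude

Helper file (supports stmt-HodgeConjecture-13679). The X-at-`(S, S)` line for the item (seats 3,
13681-0, 13681-2, 13679-3: `realMultiplicationSqrtTwoAlgebraic_of_twinSimilitude_of_twoSelfSimilar`)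
needs exactly one topological input about a projective K3 surface `S`: a rational
`2`-self-similitude of `(H²(S(ℂ); ℚ), ∪)`, i.e. `H²(S, ℚ)(2) ≅ H²(S, ℚ)`. So far the tree derives it
from the marking (`Λ_{K3}(2) ↪ Λ_{K3}`), i.e. from `b₂ = 22`, evenness AND index `−16` (Milnor).
This file proves the lattice-theoretic fact that makes evenness and the index superfluous:

* `exists_ratMatrix_twoSimilitude` — for every symmetric integer matrix `G` with `det G = ±1` and
  an EVEN number of rows there is a rational matrix `A` with `Aᵀ G A = 2G`.

Proof. `G ⊕ ⟨1⟩ ⊕ ⟨−1⟩` is symmetric, unimodular, odd and indefinite, hence diagonalisable over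
`ℤ` with unit squares (Serre, *A Course in Arithmetic*, Ch. V §2.2 Thm. 4 — the tree's
`isDiagonalizable_of_isOdd_of_isIndefinite`, resting on Serre's Thm. 3 / Meyer, all proved in the
tree). A diagonal form `⟨ε₁, …, ε_{2h}⟩`, `εᵢ = ±1`, has the rational `2`-similitude made of the
`2 × 2` blocks `[[1,1],[1,−1]]` (on `⟨ε, ε⟩`) and `½[[3,1],[1,3]]` (on `⟨ε, −ε⟩`); so
`(ℚ^ι ⊕ ℚ², G ⊕ ⟨1,−1⟩)` has a `2`-self-similitude `F`. The plane `P = ⟨1, −1⟩` has the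
`½`-similitude `¼[[3,−1],[−1,3]]`, so `σ := F ∘ (0 ⊕ ¼[[3,−1],[−1,3]])|_P` is an isometric
embedding of `P`; by WITT'S THEOREM (Iversen Ch. I Thm. 2.4, the tree's
`Witt_isometry_extension_holds`) it extends to an isometry `τ`, and `τ⁻¹ ∘ F` is a
`2`-self-similitude preserving `P`, hence `P^⊥ = ℚ^ι`: its compression is the required `A`
(Witt cancellation). For ODD rank no such `A` exists (`det`), so parity is the exact condition.

Everything here is proved; no definition and no named fact is introduced. Consumer: the sibling
file `NikulinTwinTransportRealMultiplicationOfEvenBetti` (the item from X + `b₂(K3)` even).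
Prover seat prover-pitem-stmt-HodgeConjecture-13679-c3-0.

## References

* [Serre1973] J.-P. Serre, *A Course in Arithmetic*, GTM 7, Ch. V §2.2 Thm. 4, §3.
* [Iversen1992] B. Iversen, *Hyperbolic Geometry*, LMS Student Texts 25, Ch. I §2 Thm. 2.4.
* [MilnorHusemoller1973] J. Milnor, D. Husemoller, *Symmetric Bilinear Forms*, Ch. I §3, II §4.
-/

namespace Summit.HodgeConjecture.HodgeConjecture.Theorems.NikulinTwinTransport

open Module Matrix
open LinearMap (BilinForm)
open LinearMap.BilinForm
open Literature.LinearAlgebra.QuadraticForm (Witt_isometry_extension_holds)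

/-! ### Block formula for `toBilin'` of a block-diagonal matrix -/

/-- The bilinear form of `A ⊕ D` splits as the sum of the forms of `A` and `D` on the two groups of
coordinates. [folklore] -/
theorem toBilin'_fromBlocks_diag {R : Type*} [CommRing R] {ι κ : Type*} [Fintype ι] [Fintype κ]
    [DecidableEq ι] [DecidableEq κ] (A : Matrix ι ι R) (D : Matrix κ κ R) (v w : ι ⊕ κ → R) :
    Matrix.toBilin' (Matrix.fromBlocks A 0 0 D) v w =
      Matrix.toBilin' A (v ∘ Sum.inl) (w ∘ Sum.inl) + Matrix.toBilin' D (v ∘ Sum.inr) (w ∘ Sum.inr) := by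
  rw [Matrix.toBilin'_apply', Matrix.toBilin'_apply', Matrix.toBilin'_apply', Matrix.fromBlocks_mulVec,
    Matrix.zero_mulVec, Matrix.zero_mulVec, add_zero, zero_add]
  conv_lhs => rw [← Sum.elim_comp_inl_inr v]
  rw [sumElim_dotProduct_sumElim]

/-! ### The `2 × 2` blocks -/

/-- **`⟨a⟩ ⊕ ⟨c⟩` (`a, c = ±1`) has a rational `2`-self-similitude**: `[[1,1],[1,−1]]` if `a = c`,
`½[[3,1],[1,3]]` if `a = −c`. [folklore] -/
theorem exists_twoSimilitude_fin_two (v : Fin 2 → ℚ) (h0 : v 0 = 1 ∨ v 0 = -1)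
    (h1 : v 1 = 1 ∨ v 1 = -1) :
    ∃ t : Matrix (Fin 2) (Fin 2) ℚ, tᵀ * Matrix.diagonal v * t = (2 : ℚ) • Matrix.diagonal v := by
  have hv : v = ![v 0, v 1] := by
    funext s; fin_cases s <;> rfl
  rw [hv]
  rcases h0 with h0 | h0 <;> rcases h1 with h1 | h1 <;> rw [h0, h1]
  · refine ⟨!![1, 1; 1, -1], ?_⟩
    ext i j; fin_cases i <;> fin_cases j <;>
      simp [Matrix.mul_apply, Fin.sum_univ_two, Matrix.diagonal_apply] <;> norm_num
  · refine ⟨!![3 / 2, 1 / 2; 1 / 2, 3 / 2], ?_⟩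
    ext i j; fin_cases i <;> fin_cases j <;>
      simp [Matrix.mul_apply, Fin.sum_univ_two, Matrix.diagonal_apply] <;> norm_num
  · refine ⟨!![3 / 2, 1 / 2; 1 / 2, 3 / 2], ?_⟩
    ext i j; fin_cases i <;> fin_cases j <;>
      simp [Matrix.mul_apply, Fin.sum_univ_two, Matrix.diagonal_apply] <;> norm_num
  · refine ⟨!![1, 1; 1, -1], ?_⟩
    ext i j; fin_cases i <;> fin_cases j <;>
      simp [Matrix.mul_apply, Fin.sum_univ_two, Matrix.diagonal_apply] <;> norm_num

/-- The plane `⟨1⟩ ⊕ ⟨−1⟩` has a rational `½`-self-similitude `¼[[3,−1],[−1,3]]`. [folklore] -/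
theorem halfSimilitude_fin_two :
    (!![3 / 4, -1 / 4; -1 / 4, 3 / 4] : Matrix (Fin 2) (Fin 2) ℚ)ᵀ * Matrix.diagonal ![(1 : ℚ), -1] *
        !![3 / 4, -1 / 4; -1 / 4, 3 / 4] = (1 / 2 : ℚ) • Matrix.diagonal ![(1 : ℚ), -1] := by
  ext i j; fin_cases i <;> fin_cases j <;>
    simp [Matrix.mul_apply, Fin.sum_univ_two, Matrix.diagonal_apply] <;> norm_num

/-- `¼[[3,−1],[−1,3]]` is injective on `ℚ²`. [folklore] -/
theorem mulVec_halfSimilitude_eq_zero {z : Fin 2 → ℚ}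
    (hz : (!![3 / 4, -1 / 4; -1 / 4, 3 / 4] : Matrix (Fin 2) (Fin 2) ℚ) *ᵥ z = 0) : z = 0 := by
  have h0 := congr_fun hz 0
  have h1 := congr_fun hz 1
  simp [Matrix.mulVec, dotProduct, Fin.sum_univ_two] at h0 h1
  funext s
  fin_cases s
  · simp only [Fin.zero_eta, Pi.zero_apply]; linarith
  · simp only [Fin.mk_one, Pi.zero_apply]; linarith

/-! ### A rational `2`-self-similitude of a diagonal unit form of even rank -/

/-- **`⟨ε₁⟩ ⊕ ⋯ ⊕ ⟨ε_{2h}⟩`, `εᵢ = ±1`, has a rational `2`-self-similitude** (block sum of the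
`2 × 2` similitudes of `exists_twoSimilitude_fin_two`, the coordinates being paired as
`(0, j), (1, j)`). [folklore] -/
theorem exists_twoSimilitude_diagonal {h : ℕ} (d : Fin 2 × Fin h → ℚ)
    (hd : ∀ k, d k = 1 ∨ d k = -1) :
    ∃ T : Matrix (Fin 2 × Fin h) (Fin 2 × Fin h) ℚ,
      Tᵀ * Matrix.diagonal d * T = (2 : ℚ) • Matrix.diagonal d := by
  have hblk : ∀ j : Fin h, ∃ t : Matrix (Fin 2) (Fin 2) ℚ,
      tᵀ * Matrix.diagonal (fun s => d (s, j)) * t = (2 : ℚ) • Matrix.diagonal (fun s => d (s, j)) :=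
    fun j => exists_twoSimilitude_fin_two _ (hd (0, j)) (hd (1, j))
  choose t ht using hblk
  refine ⟨Matrix.blockDiagonal t, ?_⟩
  have hD : Matrix.diagonal d = Matrix.blockDiagonal fun j => Matrix.diagonal fun s => d (s, j) := by
    rw [Matrix.blockDiagonal_diagonal]
  rw [hD, Matrix.blockDiagonal_transpose, ← Matrix.blockDiagonal_mul, ← Matrix.blockDiagonal_mul,
    ← Matrix.blockDiagonal_smul]
  congr 1
  funext j
  exact ht j

/-! ### The main lemma -/

/-- **Every unimodular lattice of even rank has a rational `2`-self-similitude.** For a symmetric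
integer matrix `G` with `det G = ±1` and an even number of rows there is a rational matrix `A`
with `Aᵀ G A = 2 G`. Proof (module docstring): diagonalise the odd indefinite unimodular lattice
`G ⊕ ⟨1⟩ ⊕ ⟨−1⟩` over `ℤ` (Serre Ch. V Thm. 4, tree: `isDiagonalizable_of_isOdd_of_isIndefinite`
with `exists_isotropic_of_isIndefinite_holds`), take the block `2`-similitude of the diagonal unit
form, and cancel the plane `⟨1⟩ ⊕ ⟨−1⟩` by Witt's theorem (tree: `Witt_isometry_extension_holds`).
[cite: Serre1973, Ch. V §2.2 Thm. 4] [cite: Iversen1992, Ch. I §2 Thm. 2.4] -/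
theorem exists_ratMatrix_twoSimilitude {ι : Type} [Fintype ι] [DecidableEq ι]
    (G : Matrix ι ι ℤ) (hGt : G.transpose = G) (hGu : IsUnit G.det) (hι : Even (Fintype.card ι)) :
    ∃ A : Matrix ι ι ℚ,
      Aᵀ * G.map (Int.cast : ℤ → ℚ) * A = (2 : ℚ) • G.map (Int.cast : ℤ → ℚ) := by
  classical
  /- Step 1: the odd indefinite unimodular enlargement `H = G ⊕ ⟨1⟩ ⊕ ⟨−1⟩` and its
  diagonalisation over `ℤ`. -/
  set D2 : Matrix (Fin 2) (Fin 2) ℤ := Matrix.diagonal ![1, -1] with hD2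
  set H : Matrix (ι ⊕ Fin 2) (ι ⊕ Fin 2) ℤ := Matrix.fromBlocks G 0 0 D2 with hH
  set Q : BilinForm ℤ (ι ⊕ Fin 2 → ℤ) := Matrix.toBilin' H with hQ
  have hHt : H.IsSymm := by
    rw [hH, Matrix.isSymm_fromBlocks_iff]
    exact ⟨hGt, by simp, by simp, Matrix.isSymm_diagonal _⟩
  have hQs : Q.IsSymm := Matrix.isSymm_toBilin'_iff_isSymm.mpr hHt
  have hHdet : IsUnit H.det := by
    rw [hH, Matrix.det_fromBlocks_zero₂₁]
    refine hGu.mul ?_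
    rw [hD2, Matrix.det_diagonal]
    simp [Fin.prod_univ_two]
  have hQu : Q.IsUnimodular := by
    rw [isUnimodular_iff_isUnit_det_holds Q (Pi.basisFun ℤ (ι ⊕ Fin 2)),
      LinearMap.BilinForm.toMatrix_basisFun, hQ, LinearMap.BilinForm.toMatrix'_toBilin']
    exact hHdet
  have hx1 : Q (Pi.single (Sum.inr 0) 1) (Pi.single (Sum.inr 0) 1) = 1 := by
    rw [hQ, Matrix.toBilin'_single, hH, Matrix.fromBlocks_apply₂₂, hD2, Matrix.diagonal_apply_eq]
    rfl
  have hx2 : Q (Pi.single (Sum.inr 1) 1) (Pi.single (Sum.inr 1) 1) = -1 := by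
    rw [hQ, Matrix.toBilin'_single, hH, Matrix.fromBlocks_apply₂₂, hD2, Matrix.diagonal_apply_eq]
    rfl
  have hne : ∀ s : Fin 2, (Pi.single (Sum.inr s) 1 : ι ⊕ Fin 2 → ℤ) ≠ 0 := fun s h0 => by
    have := congr_fun h0 (Sum.inr s)
    simp at this
  have hodd : Q.IsOdd := (isOdd_iff Q).2 ⟨_, by rw [hx1]; exact odd_one⟩
  have hind : Q.IsIndefinite := by
    rw [isIndefinite_iff, posDef_iff, negDef_iff]
    refine ⟨fun hpos => ?_, fun hneg => ?_⟩
    · have := hpos _ (hne 1); rw [hx2] at this; norm_num at this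
    · have := hneg _ (hne 0); rw [hx1] at this; norm_num at this
  obtain ⟨ι', b, hb⟩ :=
    isDiagonalizable_of_isOdd_of_isIndefinite exists_isotropic_of_isIndefinite_holds hQs hQu hodd hind
  haveI : Finite ι' := Module.Finite.finite_basis b
  letI : Fintype ι' := Fintype.ofFinite ι'
  -- the rank `card ι + 2` is even: reindex the orthogonal basis by `Fin 2 × Fin m`
  obtain ⟨h', hh'⟩ := hι
  set m : ℕ := h' + 1 with hm
  have hcard : Fintype.card ι' = Fintype.card (Fin 2 × Fin m) := by
    have h1 : Module.finrank ℤ (ι ⊕ Fin 2 → ℤ) = Fintype.card ι' := Module.finrank_eq_card_basis b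
    rw [Module.finrank_fintype_fun_eq_card, Fintype.card_sum, Fintype.card_fin] at h1
    rw [← h1, Fintype.card_prod, Fintype.card_fin, Fintype.card_fin, hh', hm]
    ring
  obtain ⟨ψ⟩ := Fintype.card_eq.1 hcard
  set b' : Basis (Fin 2 × Fin m) ℤ (ι ⊕ Fin 2 → ℤ) := b.reindex ψ with hb'def
  have hb' : LinearMap.IsOrthoᵢ Q b' := fun i j hij => by
    simp only [Function.onFun, hb'def, Module.Basis.reindex_apply]
    exact hb (ψ.symm.injective.ne hij)
  set d : Fin 2 × Fin m → ℤ := fun k => Q (b' k) (b' k) with hddef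
  have hd1 : ∀ k, d k = 1 ∨ d k = -1 := fun k => apply_basis_self_eq_one_or_of_isOrthoᵢ hQu hb' k
  have heqv : Q.Equivalent (Matrix.toBilin' (Matrix.diagonal d)) := by
    rw [hddef, ← toMatrix_eq_diagonal_of_isOrthoᵢ hb']
    exact equivalent_toBilin'_toMatrix Q b'
  obtain ⟨e⟩ := heqv
  /- Step 2: the change-of-basis matrices over `ℤ` and the relation `Eᵀ (diag d) E = H`. -/
  set eL : (ι ⊕ Fin 2 → ℤ) ≃ₗ[ℤ] (Fin 2 × Fin m → ℤ) := e.toLinearEquiv with heL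
  set E : Matrix (Fin 2 × Fin m) (ι ⊕ Fin 2) ℤ := LinearMap.toMatrix' eL.toLinearMap with hE
  set E' : Matrix (ι ⊕ Fin 2) (Fin 2 × Fin m) ℤ := LinearMap.toMatrix' eL.symm.toLinearMap with hE'
  have hEE' : E * E' = 1 := by
    rw [hE, hE', ← LinearMap.toMatrix'_comp, LinearEquiv.comp_symm, LinearMap.toMatrix'_id]
  have hEDE : Eᵀ * Matrix.diagonal d * E = H := by
    have hc : (Matrix.toBilin' (Matrix.diagonal d)).comp eL.toLinearMap eL.toLinearMap = Q := by
      refine LinearMap.BilinForm.ext fun x y => ?_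
      rw [LinearMap.BilinForm.comp_apply]
      exact e.map_app y x
    have h2 := LinearMap.BilinForm.toMatrix'_comp (Matrix.toBilin' (Matrix.diagonal d))
      eL.toLinearMap eL.toLinearMap
    rw [hc, hQ, LinearMap.BilinForm.toMatrix'_toBilin', LinearMap.BilinForm.toMatrix'_toBilin'] at h2
    rw [hE]
    exact h2.symm
  /- Step 3: pass to `ℚ`. -/
  set f : ℤ →+* ℚ := Int.castRingHom ℚ with hf
  set Hq : Matrix (ι ⊕ Fin 2) (ι ⊕ Fin 2) ℚ := H.map f with hHq
  set Dq : Matrix (Fin 2 × Fin m) (Fin 2 × Fin m) ℚ := (Matrix.diagonal d).map f with hDq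
  set Eq : Matrix (Fin 2 × Fin m) (ι ⊕ Fin 2) ℚ := E.map f with hEq
  set E'q : Matrix (ι ⊕ Fin 2) (Fin 2 × Fin m) ℚ := E'.map f with hE'q
  have hEE'q : Eq * E'q = 1 := by
    rw [hEq, hE'q, ← Matrix.map_mul, hEE', Matrix.map_one _ (map_zero f) (map_one f)]
  have hEDEq : Eqᵀ * Dq * Eq = Hq := by
    rw [hEq, hDq, hHq, ← hEDE, Matrix.map_mul, Matrix.map_mul, Matrix.transpose_map]
  have hDq' : Dq = Matrix.diagonal fun k => (d k : ℚ) := by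
    rw [hDq, Matrix.diagonal_map (map_zero f)]
    rfl
  have hd1q : ∀ k, (d k : ℚ) = 1 ∨ (d k : ℚ) = -1 := fun k => by
    rcases hd1 k with h | h <;> simp [h]
  /- Step 4: the block `2`-similitude of `Dq` and the `2`-similitude `A_W` of `Hq`. -/
  obtain ⟨T, hT⟩ := exists_twoSimilitude_diagonal (fun k => (d k : ℚ)) hd1q
  rw [← hDq'] at hT
  set AW : Matrix (ι ⊕ Fin 2) (ι ⊕ Fin 2) ℚ := E'q * T * Eq with hAW
  have h1 : E'qᵀ * Hq * E'q = Dq := by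
    rw [← hEDEq]
    calc E'qᵀ * (Eqᵀ * Dq * Eq) * E'q = (Eq * E'q)ᵀ * Dq * (Eq * E'q) := by
          rw [Matrix.transpose_mul]; simp only [Matrix.mul_assoc]
      _ = Dq := by rw [hEE'q, Matrix.transpose_one, Matrix.one_mul, Matrix.mul_one]
  have hAW2 : AWᵀ * Hq * AW = (2 : ℚ) • Hq := by
    calc AWᵀ * Hq * AW = Eqᵀ * (Tᵀ * (E'qᵀ * Hq * E'q) * T) * Eq := by
          rw [hAW, Matrix.transpose_mul, Matrix.transpose_mul]; simp only [Matrix.mul_assoc]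
      _ = Eqᵀ * ((2 : ℚ) • Dq) * Eq := by rw [h1, hT]
      _ = (2 : ℚ) • Hq := by rw [Matrix.mul_smul, Matrix.smul_mul, hEDEq]
  /- Step 5: Witt cancellation of the plane `⟨1⟩ ⊕ ⟨−1⟩` over `ℚ`. -/
  set Gq : Matrix ι ι ℚ := G.map f with hGq
  set D2q : Matrix (Fin 2) (Fin 2) ℚ := Matrix.diagonal ![(1 : ℚ), -1] with hD2q
  have hHq' : Hq = Matrix.fromBlocks Gq 0 0 D2q := by
    have hv : (fun s => f (![1, -1] s)) = ![(1 : ℚ), -1] := by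
      funext s; fin_cases s <;> simp [hf]
    rw [hHq, hH, Matrix.fromBlocks_map, hGq, hD2q, hD2, Matrix.diagonal_map (map_zero f), hv,
      Matrix.map_zero _ (map_zero f), Matrix.map_zero _ (map_zero f)]
  set B : BilinForm ℚ (ι ⊕ Fin 2 → ℚ) := Matrix.toBilin' Hq with hB
  have hBs : B.IsSymm := Matrix.isSymm_toBilin'_iff_isSymm.mpr (hHt.map _)
  have hBn : B.Nondegenerate := by
    refine LinearMap.BilinForm.nondegenerate_toBilin'_of_det_ne_zero' _ ?_
    rw [hHq, hf, ← RingHom.mapMatrix_apply, ← RingHom.map_det]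
    obtain ⟨u, hu⟩ := hHdet
    rw [← hu]
    rcases Int.units_eq_one_or u with h | h <;> simp [h]
  -- values of `B`
  have hBval : ∀ v w : ι ⊕ Fin 2 → ℚ, B v w =
      Matrix.toBilin' Gq (v ∘ Sum.inl) (w ∘ Sum.inl) + Matrix.toBilin' D2q (v ∘ Sum.inr) (w ∘ Sum.inr) :=
    fun v w => by rw [hB, hHq', toBilin'_fromBlocks_diag]
  -- the `2`-similitude `F`
  set F : (ι ⊕ Fin 2 → ℚ) →ₗ[ℚ] (ι ⊕ Fin 2 → ℚ) := Matrix.toLin' AW with hF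
  have hF2 : ∀ x y, B (F x) (F y) = 2 * B x y := fun x y => by
    have hc : B.comp F F = (2 : ℚ) • B := by
      rw [hB, hF, Matrix.toBilin'_comp, hAW2, map_smul]
    have := LinearMap.congr_fun₂ hc x y
    simpa only [LinearMap.BilinForm.comp_apply, LinearMap.smul_apply, smul_eq_mul] using this
  have hFinj : ∀ x, F x = 0 → x = 0 := fun x hx =>
    hBn.1 x fun y => by
      have := hF2 x y
      rw [hx, LinearMap.BilinForm.zero_left] at this
      linarith
  -- the `½`-similitude `J = 0 ⊕ ¼[[3,−1],[−1,3]]` of the plane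
  set Smat : Matrix (Fin 2) (Fin 2) ℚ := !![3 / 4, -1 / 4; -1 / 4, 3 / 4] with hSmat
  set Jmat : Matrix (ι ⊕ Fin 2) (ι ⊕ Fin 2) ℚ := Matrix.fromBlocks 0 0 0 Smat with hJmat
  set J : (ι ⊕ Fin 2 → ℚ) →ₗ[ℚ] (ι ⊕ Fin 2 → ℚ) := Matrix.toLin' Jmat with hJ
  have hJinl : ∀ u : ι ⊕ Fin 2 → ℚ, (J u) ∘ Sum.inl = 0 := fun u => by
    funext i
    simp only [hJ, hJmat, Matrix.toLin'_apply, Matrix.fromBlocks_mulVec, Matrix.zero_mulVec, add_zero,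
      Function.comp_apply, Sum.elim_inl, Pi.zero_apply]
  have hJinr : ∀ u : ι ⊕ Fin 2 → ℚ, (J u) ∘ Sum.inr = Smat *ᵥ (u ∘ Sum.inr) := fun u => by
    funext s
    simp only [hJ, hJmat, Matrix.toLin'_apply, Matrix.fromBlocks_mulVec, Matrix.zero_mulVec, zero_add,
      Function.comp_apply, Sum.elim_inr]
  have hJJ : ∀ u v : ι ⊕ Fin 2 → ℚ, B (J u) (J v) = (1 / 2 : ℚ) * Matrix.toBilin' D2q (u ∘ Sum.inr) (v ∘ Sum.inr) :=
    fun u v => by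
    rw [hBval, hJinl, hJinl, LinearMap.BilinForm.zero_left, zero_add, hJinr, hJinr,
      ← Matrix.toLin'_apply, ← Matrix.toLin'_apply, ← LinearMap.BilinForm.comp_apply,
      Matrix.toBilin'_comp, hD2q, hSmat, halfSimilitude_fin_two, map_smul, LinearMap.smul_apply,
      LinearMap.smul_apply, smul_eq_mul]
  -- the plane `P = {inl-coordinates zero}` and the isometric embedding `σ = F ∘ J |_P`
  set U : Submodule ℚ (ι ⊕ Fin 2 → ℚ) := LinearMap.ker (LinearMap.funLeft ℚ ℚ (Sum.inl : ι → ι ⊕ Fin 2))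
    with hU
  have hUmem : ∀ u : ι ⊕ Fin 2 → ℚ, u ∈ U ↔ u ∘ Sum.inl = 0 := fun u => by
    rw [hU, LinearMap.mem_ker]
    rfl
  have hBU : ∀ u v : ι ⊕ Fin 2 → ℚ, u ∘ Sum.inl = 0 →
      B u v = Matrix.toBilin' D2q (u ∘ Sum.inr) (v ∘ Sum.inr) := fun u v hu => by
    rw [hBval, hu, LinearMap.BilinForm.zero_left, zero_add]
  set σ : U →ₗ[ℚ] (ι ⊕ Fin 2 → ℚ) := (F ∘ₗ J).domRestrict U with hσ
  have hσapp : ∀ u : U, σ u = F (J u) := fun u => rfl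
  have hσB : ∀ u v : U, B (σ u) (σ v) = B u v := fun u v => by
    rw [hσapp, hσapp, hF2, hJJ, hBU _ _ ((hUmem _).1 u.2)]
    ring
  have hσinj : Function.Injective σ := by
    rw [injective_iff_map_eq_zero]
    intro u hu
    rw [hσapp] at hu
    have hJu : J u = 0 := hFinj _ hu
    have h2 : (u : ι ⊕ Fin 2 → ℚ) ∘ Sum.inr = 0 := by
      refine mulVec_halfSimilitude_eq_zero ?_
      rw [← hSmat, ← hJinr, hJu]
      rfl
    have h1 : (u : ι ⊕ Fin 2 → ℚ) ∘ Sum.inl = 0 := (hUmem _).1 u.2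
    ext k
    rcases k with i | s
    · exact congr_fun h1 i
    · exact congr_fun h2 s
  obtain ⟨τ, hτB, hτU⟩ := Witt_isometry_extension_holds ℚ (by norm_num) (ι ⊕ Fin 2 → ℚ) B hBs hBn
    U σ hσinj hσB
  /- Step 6: `Φ = τ⁻¹ ∘ F` is a `2`-similitude preserving `P`, hence `P^⊥ = ℚ^ι`. -/
  set Φ : (ι ⊕ Fin 2 → ℚ) →ₗ[ℚ] (ι ⊕ Fin 2 → ℚ) := τ.symm.toLinearMap ∘ₗ F with hΦ
  have hΦapp : ∀ x, Φ x = τ.symm (F x) := fun x => rfl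
  have hτsymm : ∀ a w, B (τ.symm a) w = B a (τ w) := fun a w => by
    conv_rhs => rw [← τ.apply_symm_apply a]
    rw [hτB]
  have hΦ2 : ∀ x y, B (Φ x) (Φ y) = 2 * B x y := fun x y => by
    rw [hΦapp, hΦapp, hτsymm, τ.apply_symm_apply, hF2]
  have hΦV : ∀ x : ι ⊕ Fin 2 → ℚ, x ∘ Sum.inr = 0 → (Φ x) ∘ Sum.inr = 0 := fun x hx => by
    funext s
    -- test against the basis vector `u_s = δ_{inr s} ∈ P`
    set us : ι ⊕ Fin 2 → ℚ := Pi.single (Sum.inr s) 1 with hus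
    have hus_inl : us ∘ Sum.inl = 0 := by
      funext i; simp [hus]
    have hus_inr : us ∘ Sum.inr = Pi.single s 1 := by
      funext t; by_cases hts : t = s <;> simp [hus, hts]
    have husU : us ∈ U := (hUmem _).2 hus_inl
    -- `B (Φ x) u_s = B (F x) (τ u_s) = B (F x) (σ u_s) = 2 B x (J u_s) = 0`
    have hzero : B (Φ x) us = 0 := by
      rw [hΦapp, hτsymm, show τ us = σ ⟨us, husU⟩ from hτU ⟨us, husU⟩, hσapp, hF2, hBval, hx, hJinl,
        LinearMap.BilinForm.zero_right, LinearMap.BilinForm.zero_left, add_zero, mul_zero]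
    -- `B (Φ x) u_s = (Φ x)(inr s) · (±1)`
    rw [hBval, hus_inl, LinearMap.BilinForm.zero_right, zero_add, hus_inr, Matrix.toBilin'_apply',
      hD2q, Matrix.diagonal_mulVec_single, dotProduct_single, mul_one] at hzero
    rcases mul_eq_zero.1 hzero with h | h
    · exact h
    · exfalso; revert h; fin_cases s <;> simp
  -- compression of `Φ` to `ℚ^ι`
  set extV : (ι → ℚ) →ₗ[ℚ] (ι ⊕ Fin 2 → ℚ) :=
    { toFun := fun x => Sum.elim x 0
      map_add' := fun x y => by funext k; rcases k with i | s <;> simp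
      map_smul' := fun c x => by funext k; rcases k with i | s <;> simp } with hextV
  have hextV_inl : ∀ x, (extV x) ∘ Sum.inl = x := fun x => rfl
  have hextV_inr : ∀ x, (extV x) ∘ Sum.inr = 0 := fun x => rfl
  set ΦV : (ι → ℚ) →ₗ[ℚ] (ι → ℚ) := LinearMap.funLeft ℚ ℚ (Sum.inl : ι → ι ⊕ Fin 2) ∘ₗ Φ ∘ₗ extV
    with hΦVdef
  have hΦVapp : ∀ x, ΦV x = (Φ (extV x)) ∘ Sum.inl := fun x => rfl
  have hΦext : ∀ x, Φ (extV x) = extV (ΦV x) := fun x => by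
    have h0 := hΦV (extV x) (hextV_inr x)
    conv_lhs => rw [← Sum.elim_comp_inl_inr (Φ (extV x))]
    rw [h0]
    rfl
  have hBext : ∀ a c : ι → ℚ, B (extV a) (extV c) = Matrix.toBilin' Gq a c := fun a c => by
    rw [hBval, hextV_inl, hextV_inl, hextV_inr, LinearMap.BilinForm.zero_left, add_zero]
  have hΦV2 : ∀ x y, Matrix.toBilin' Gq (ΦV x) (ΦV y) = 2 * Matrix.toBilin' Gq x y := fun x y => by
    rw [← hBext, ← hBext, ← hΦext, ← hΦext, hΦ2]
  /- Conclusion: `A = [ΦV]` satisfies `Aᵀ G A = 2 G`. -/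
  refine ⟨LinearMap.toMatrix' ΦV, ?_⟩
  have hc : (Matrix.toBilin' Gq).comp ΦV ΦV = (2 : ℚ) • Matrix.toBilin' Gq :=
    LinearMap.BilinForm.ext fun x y => by
      rw [LinearMap.BilinForm.comp_apply, LinearMap.smul_apply, LinearMap.smul_apply, smul_eq_mul, hΦV2]
  have h3 := LinearMap.BilinForm.toMatrix'_comp (Matrix.toBilin' Gq) ΦV ΦV
  rw [hc, map_smul, LinearMap.BilinForm.toMatrix'_toBilin'] at h3
  rw [show G.map (Int.cast : ℤ → ℚ) = Gq from rfl]
  exact h3.symm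

end Summit.HodgeConjecture.HodgeConjecture.Theorems.NikulinTwinTransport
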